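import Summits.CriticalPhenomena.CardyFormulaZ2.Theorems.CardySelfRefinementLagHandOffReduction
import Summits.CriticalPhenomena.CardyFormulaZ2.Theorems.CardySelfRefinementLagHandOffNoTouchReIm
import Summits.CriticalPhenomena.CardyFormulaZ2.Theorems.CardySelfRefinementLagHandOffNoTouchCountable
import Summits.CriticalPhenomena.CardyFormulaZ2.Theorems.CardySelfRefinementLagHandOffTournamentRigidity
import Summits.CriticalPhenomena.CardyFormulaZ2.Theorems.CardySelfRefinementLagHandOffTightness
import Summits.CriticalPhenomena.CardyFormulaZ2.Theorems.CardySelfRefinementLagHandOffNoIdle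
import HarnessLib.Audit

/-!
# Line `hitting-tournament` — skeleton for crux `CardySelfRefinement.LagHandOff`
(item stmt-CriticalPhenomena-10268, route route-CriticalPhenomena-CardySelfRefinement)

LEAD-OWNED copy, ninth lead seat (prover-line-stmt-CriticalPhenomena-10268-c7-0, 2026-08-17T13Z–, cycle 1),
continuing c6: registered stubs UNCHANGED (R1 `stub_quadTransfer`, R2‴ `stub_slitHandOffDyadic`; glue
`lagHandOff_of_stubs` landed, p127346).  Seat c7 works the kernel entry K1 `stub_closeEncounter` (strategist
line `mushroom-transfer`, registered on the item, a `--supports` target of this line) with a new cut: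
(i) FINITE RENEWAL — K1 follows from a per-attempt lemma at the stopping times "first ε′-approach to a
boundary point whose ε-ball is touch-free so far" by the strong Markov property of the one-bit exploration
orbit (`cornerOrbit` / `nextCorner`: the prefix is determined by the bits it read) and a packing bound on `∂D`
at the FIXED scale `ε` (attempt centres are `ε/2`-separated once every attempt is followed by a touch within
`√(ε ε′)` of its centre), so no union over boundary locations at the vanishing scale is ever taken;
(ii) the per-attempt lemma is Camia–Newman 2007 Lemma 7.1 in its SIMPLE case (pp. 52–53: fresh side
sectors, RSW laterals, trap ⇒ the only exit is a visit of an arc-adjacent edge), because at the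
exploration's OWN wired / dual-wired arcs a lateral landing on `∂D` closes the trap — the mushroom case of
CN07 (free arcs `J ∖ J′`, Lemmas 7.3/7.4) is not needed for K1 as registered and belongs to the coupling
lemmas behind K2/K5.  Previous header (seat c6) kept below.

## (seat c6 header, kept)

LEAD-OWNED copy, eighth lead seat (prover-line-stmt-CriticalPhenomena-10268-c6-0, 2026-08-17T05–11Z, cycle 1),
continuing c5: registered stubs UNCHANGED (R1 `stub_quadTransfer`, R2‴ `stub_slitHandOffDyadic`; glue
`lagHandOff_of_stubs` landed, p127346).  Seat c6 (KERNEL-c6.md): (1) the rough-boundary kernel is CI-FREE —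
Camia–Newman 2007 §7 nets boundary locations at a FIXED scale and absorbs the vanishing scale into
"mushroom ⊆ {Q′ crossed} ∖ {Q″ crossed}", whose only conformal input (CN07 Lemma 7.3) is the tree's
Schramm–Smirnov continuity (`SchrammSmirnov2011_lemma_5_1_holds`, all quads; strategist line
`mushroom-transfer`, stubs K1 `stub_closeEncounter`, K2 `stub_noBoundaryPinch`, K3 `stub_sixArm`
are `--supports` targets of this line too); LANDED toward K1/K2: the quad half of the no-mushroom
inclusion (M1 `stub_kernel_quadSqueeze_side0` p150870, M2 `…_lateral` p150905, M3
`stub_kernel_quadCrossingExclusion` p151280); (2) K3 reduced to the classical two-radii five-arm upper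
bound (`stub_sixArm_of_fiveArm` p147306; aux p147129, p147228); (3) FLAT BNM THEOREM landed end-to-end
(`stub_kernel_flatPieceMisdockVanishes2` p153236: under a flat piece of the wired arc, misdocked
macroscopic clusters have no ρ-low point w.h.p.; ingredients D p150993 (+p149507/p149582/p149598/
p150771), B p146065, LINK/LINK2 p147542/p151791, STRIP/STRIP2 p149510/p152138, FLAT-GEOM p149726,
CORNER p149907).  Previous header (seat c5) kept below.

## (seat c5 header, kept)

LEAD-OWNED copy, seventh lead seat (prover-line-stmt-CriticalPhenomena-10268-c5-0, 2026-08-16T23:07Z),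
continuing c4 (21:56Z) and c3 (21:27Z): registered stubs UNCHANGED (R1 `stub_quadTransfer`, R2‴
`stub_slitHandOffDyadic`; glue `lagHandOff_of_stubs` landed, p127346).  Seat c5 works the common
boundary kernel of both stubs in its contact-edge form — misdocking probability of a macroscopic
cluster `C` given the arc-deleted configuration is exactly `2^{-κ(C)}`, `κ` = number of contact
edges to the wired arc, so the kernel is (FC) "few contacts are rare" + (NM₀) "ρ-approach forces
adjacency" — with Schramm–Smirnov lowest-crossing pinning (the tree's Lemma 6.1(2) for arbitrary
charts, `QuadLowestCrossingProofs`) as the counting-free handle on (NM₀); numerics on the misdock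
mass (flat vs quadratic-Koch wired arc) run as a kit compute job attached to the item; provable
infrastructure lands as `--supports` helpers.  LANDED by seat c5 (eleven helper files, all
`Theorems/CardySelfRefinementLagHandOffKernel*.lean`): the contact identity (K5 p133759), the
UNIVERSAL "contacts accumulate in any Jordan domain" (K8 `stub_kernel_contactsAccumulate`
p134869; core K6 p134258; bricks K1 p132658, K2 p132870, K3 p133155, K4 p133484, K7 p134522)
and the SOFT half "no near-tracing of `∂D` uniformly along every convergent interface sequence"
(K9c `stub_kernel_noNearTrace_uniform` p135749; K9a p135411, K9b p135550).  What stays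
conjecture-grade in R1's boundary half for ROUGH `∂D` is thereby isolated as "no boundary double
visits / few-contact windows at rough wired arcs" (KERNEL-c5.md §4); for flat pieces it is the
landed undocked three-arm bound p124959.  History of seats c3/c2/c1 kept verbatim below.

## (seat c3 header, kept)

LEAD-OWNED copy, fifth lead seat (prover-line-stmt-CriticalPhenomena-10268-c3-0, 2026-08-16T21:27Z),
continuing seat c2 (18:25Z–21:24Z), seat c1 (10:20Z–18:21Z), prover-line-…-10268-1 (02:36Z) and
prover-line-…-10268-0 (crosscut-dictionary, handed back promote-stub 02:34Z).

## Cycle 1 of seat c3 (this file): the glue is now a LANDED theorem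

`Theorems/CardySelfRefinementLagHandOffReduction.lean` (p127346, ACCEPTED 21:42Z) proves, sorry-free
over landed theorems only, `lagHandOff_of_stubs : R1 → R2‴ → LagHandOff` (registered sub-goal, the
two registered stub signatures VERBATIM as hypotheses) together with the cleaner entry points
`lagHandOff_of_quadTransfer_limitMarkov : R1 → R2′ → LagHandOff` and
`lagHandOff_of_quadTransfer_slitHandOff : R1 → R2″ → LagHandOff`.  So this skeleton is reduced to
the two registered stubs and ONE line of glue; `LagHandOff` is certified to be exactly as hard as
R1 ∧ R2 and no harder.  Both stubs are conjecture-grade as wholes (GPS13 arXiv:1008.1378 Question 10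
p. 16 in joint form for `ℤ²` sublimits; the domain Markov property of `ℤ²` sublimits, Smirnov ICM
2006 §4.2 / GPS13 p. 16) and are handed back `promote-stub` with the dossier PROMOTE.md (item
evidence; also Cruxes/LagHandOff/NOTES.md): common conjecture-grade obstruction of BOTH = boundary
control at ROUGH Jordan `∂D` (no usable arm exponents in fjords/spikes of an arbitrary Jordan
boundary); everything else maps onto the Camia–Newman 2006/07 §§5–7 a-priori machinery with
universal inputs only (RSW; five-arm = 2 ⇒ six-arm > 2 by Reimer; half-plane three-arm = 2) and the
landed periphery (≈ 111 files).

## History (seats c1, c2 — kept verbatim below)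

# Line `hitting-tournament` — skeleton for crux `CardySelfRefinement.LagHandOff`
(item stmt-CriticalPhenomena-10268, route route-CriticalPhenomena-CardySelfRefinement)

LEAD-OWNED copy, fourth lead seat (prover-line-stmt-CriticalPhenomena-10268-c2-0, 2026-08-16T18:25Z),
continuing the third lead seat c1 (prover-line-…-10268-c1-0, 10:20Z–18:21Z),
continuing prover-line-…-10268-1 (picked 02:36Z) and prover-line-…-10268-0 (crosscut-dictionary,
handed back promote-stub 02:34Z).

## Cycle 1 of seat c2 (this file): wave 1 integrated, second RESHAPE (2026-08-16T20:40Z)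

LANDED in wave 1 of seat c2 (all ACCEPTED, namespace `…Cruxes.LagHandOff.HittingTournament`):
* R3a `stub_discreteLocality` (p123412, Theorems/…DiscreteLocality.lean; with …DiscreteLocalityArcs
  p121676 — the arc-correspondence lemma for nested Jordan domains via Newman cross-cuts,
  …DiscreteLocalityLattice p121944, …Geometry p123006, …Mesh p123016, …PatchCut p123101,
  …Patch p123276) — so `IsLocal` / `IsTargetIndependent` of the decoded family are THEOREMS given R1;
* (X) the UNDOCKED half-plane two-arm bound for bond-`ℤ²`, exponent `1 − ε`, by a separation-free
  bootstrap (Theorems/…HalfPlaneTwoArmUndocked{Quad,Frontier,Arch,ThreeArms,Locality,Docking,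
  DockedBound,SumTools,Sum,Reduction,Step}.lean, p123091–p124810), hence (H)
  `stub_noTouch_undockedThreeArm` (p124959, …HalfPlaneTwoArmUndocked.lean) and the first-contact
  cleanliness stubs `stub_quadTransfer_noTouchRe/Im` (p125052, …NoTouchReIm.lean): step (b) of R1's
  method is now unconditional for axis-parallel lines;
* R2′ REDUCED: `stub_limitMarkov_kernelGluing` (p122089, …KernelGluing.lean: gluing ONE Markov kernel
  over an antitone sequence of closed stopping sets is a theorem given a.s. weak left-continuity) and
  `stub_limitMarkov_of_core` (p122633, …LimitMarkov.lean: `initial`, `domain`, chordality and the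
  gluing are proved; what remains of R2′ is the SLIT HAND-OFF on an approximating class of stopping
  sets = the new registered stub `stub_slitHandOff` below, conjecture-grade, GPS13 p. 16).
LANDED in wave 2 of seat c2 (21:06Z–21:18Z): R2″ reduced once more to its DYADIC form
  (`stub_slitHandOff_of_dyadic` p126575 with …SlitHandOffDyadicApprox p126434 and the martingale
  analysis …SlitHandOffMartingale p126829: given the identification on dyadic polygons, Lévy + Hunt
  make left-continuity along `G k ↓ F` EQUIVALENT to the identification at `F`, so the residue is a
  path-regularity statement for the slit law, conjecture-grade like the identification itself);
  the estimate-free, direction-free first-contact cleanliness `stub_quadTransfer_noTouchCountable`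
  (p126717, + …NoTouchCountableTail p126550: for ANY law on curve classes without sliding, one-sided
  touching of {Re(ū z) = a} is null off a COUNTABLE set of levels) and `stub_quadTransfer_noSliding`
  (…NoSlidingArms p126621, …NoSlidingCurves p126632, assembly …NoSliding p126899).
RESHAPE: the registered stubs are now TWO — R1 `stub_quadTransfer` and R2‴ `stub_slitHandOffDyadic` — and
`LagHandOff_of` below is sorry-free over them with every other input a landed theorem.  Also noted
for R1's method: `SchrammSmirnov2011_lemma_5_1_holds` is a theorem of the tree (all quads), so the
former `stub_quadContinuity` is free; and the all-orbit `jointLimit` of a transported decoder needs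
the cut dictionary and NoTouch in GENERAL POSITION w.r.t. the lattice (rotated rational polygonal
cuts), not only lattice staircases — recorded in the lead's census.

## Cycle 1 of seat c1 (this file): integration + RESHAPE of the research core

LANDED in wave 1 of this seat (all ACCEPTED, namespace `…Cruxes.LagHandOff.HittingTournament`):
* `stub_limitCurveRegularity_noIdle` (p98236, Theorems/…NoIdle.lean; with the lightness-free
  double-points lemma `stub_noIdle_doublePointsGen` p97301) — so limit-curve regularity (chordal
  p77447 ∧ no-trace p82328 ∧ no-idle) is a THEOREM (`limitCurveRegularity` below; combined file
  Theorems/…LimitCurveRegularityAll.lean, p101961);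
* `stub_tournamentTransfer_tightness` (p97550, Theorems/…Tightness.lean) — Aizenman–Burchard
  tightness of the interface laws of a GENERAL admissible `ℤ²`-discretisation family (the tree's
  named version is canonical-data only), step (c) of the transfer;
* `stub_tournamentTransfer_{below,east,row}Dictionary` (p97689, p98618, p100432) — the exact lattice
  dictionary at straight cross-cuts in all four orientations (step (a) of the transfer).

RESHAPE (L4; analysis work/stubs/CORE-analysis.md, scratch/CoreRecut.lean). The two research-level
stubs of cycles 1–3 (`stub_tournamentTransfer` = ∃ Ψ, IsTournamentTransfer Ψ; `stub_markovLocality`)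
were re-cut at the skeleton level into FOUR registered stubs (THREE open after wave 3: R1, R2′, R3a), each either a clean conjecture-grade
statement with a printed locator or provable-now lattice geometry, and the composition
`LagHandOff_of` uses LANDED theorems only:
* `stub_quadTransfer` (R1, conjecture-grade) — the E-blind JOINT quad → interface transfer on Jordan
  domains: Garban–Pete–Schramm 2013 (arXiv:1008.1378) Question 10 p. 16 in the joint form of their
  Cor. 9, for `ℤ²` SUBSEQUENTIAL limits (p. 10); proved on `𝕋` only (Holden–Sun arXiv:1905.13207
  Prop. 6.25 p. 108, via Camia–Newman uniqueness). = `IsTournamentTransfer` minus `readsDomain`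
  (no consumer) minus `chordal` (derivable: landed regularity + the landed `stub_discretisable`).
* `stub_limitMarkov` (R2′, conjecture-grade, decoder-free) — the chordal family PINNED by a quad
  sublimit `μ` (interface laws of every admissible family of every Dobrushin domain converge to `P D`
  along every positive mesh sequence on which the full-plane quad laws converge to `μ`) is domain
  Markov in the tree's set-based sense, given discretisability of every Dobrushin domain. Werner
  2007 §3.2 (2) is the axiom; for `ℤ²` sublimits nothing is in print (Smirnov ICM 2006 §4.2 "we do
  not even have a Markov property"; GPS13 p. 16 last paragraph: fractal slit domains). NOT derivable
  from R1 (the `domain` clause factors through non-Jordan slit sets; CORE-analysis §1.3).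
* `stub_discreteLocality` (R3a) — lead-0's registered lattice statement verbatim: compatible
  admissible discretisations of NESTED Jordan domains with common exploration prefixes up to the
  stopping set (deterministic halves landed: ExplorationPrefix p75027 / ExplorationSuffix p75991 /
  CommonPrefix p72549 / JointReadings p72920). Provable-now plane topology + lattice combinatorics,
  ≥ 1 000 lines; missing inputs identified by the R3b worker: an arc-correspondence lemma for nested
  Jordan domains (orientation choice of `D''`) and lattice locality of `zdBoundary`/inner faces of
  `Ω_δ(D')` vs `Ω_δ(D)` away from `closure (D ∖ D')`; then `splitting_at_mesh` (p115087) plugs in.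
  Its former companions are THEOREMS now (waves 2–3 of this seat): `stub_discretisable` (p106229,
  every Dobrushin domain carries an admissible `ℤ²`-discretisation family — from the sibling route's
  `DiscretisationFamilyExists.eventually_labelling`) and R3b `stub_discreteSplitting` (p118156, with
  Patch p114734 / OfLabelling p114735 / Labels p114935 / Geometry p115085 / Mesh p115087).
Glue (sorry-free, all consumers landed): `exists_mem_subseqQuadLimits_tendsto_subseq` (p71502),
`isChordal_of_handsOff` (p72122), `stub_covarianceFromDictionary` (p71518; the ONLY use of
`RotationInput`/`ScaleInvariantLimits`, with `stub_translationInput` p71750),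
`stub_localityPassage2` (p74694: IsLocal ∧ IsTargetIndependent from exact lattice identities),
`stub_limitCurveRegularity_noTrace` (p82328) for no-trace on EVERY `D` (by the landed `stub_discretisable`), `hcar` from
`IsDomainMarkov` (`carrierDetermines_of_isDomainMarkov`), clause (i) outright
(`Negative.lagHandOff_clause_i`, p72336).

## The line's METHOD for R1 (status after waves 1–3 of this seat; analysis work/stubs/WAVE3-analysis.md)
(a) exact lattice dictionary at straight cross-cuts, four orientations: …TournamentTransfer p82943,
ColumnArrival p79618, ColumnWinding p82063, ColumnFirstContact p84278, ColumnEscape p95835,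
Below/East/Row p97689/p98618/p100432; MISSING: one staircase exit dictionary for lattice staircase
cross-cuts (all location + order bits; XL ≈ 1 500). (b) first-contact continuity at immediate-entry
curves (FirstContactContinuity p87524) + cleanliness of first contacts of the LIMIT curve = the
registered `stub_quadTransfer_noTouchRe/Im` (no one-sided touching of fixed axis-parallel lines at
interior points), PROVED MODULO the half-plane arm input: NoTouch p112331 (+ SidePair p106343, Event
p107446, Dict p110846, Windows p110945) gives them from (H) an undocked cluster-form half-plane
three-arm bound, and HalfPlaneThreeArmUndocked p119394 (+ PolarQuad p115603, FaceChain p115745,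
Lattice p115983, Symmetry p116242, DualGeometry p117849, Flood p117863, Docked p118124, Extraction
p118257, Bridge p118553) gives (H) from (X) an UNDOCKED half-plane two-arm bound with exponent
`1 − ε` (LSW 2002 Lemma A.1; the tree has only the docked window form `Z2HalfPlane.real_twoArm_le`):
(X) = registered-shape open item, ≈ 800 lines (cluster-frontier docking). (c) tightness of interface
laws for general admissible families (p97550) + regularity of every sublimit (`limitCurveRegularity`:
chordal p77447 ∧ no-trace p82328 ∧ no-idle p98236; combined p101961); MISSING for `NoIdleRel`: the
no-seal property (interior half needs a six-arm `2+η` bound = named fact in print, not in tree;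
boundary half is conjecture-grade for rough Jordan `∂D`). (d) tournament rigidity (p79243) on the
staircase cross-cut family `stairCuts` (closed + `LocSeparating` p114700; `NoIdleRel` from regularity
+ no-seal p119066, with StairCutsTopology p116240 / Legs p118104 / Arc p118685); abstract bit passage
+ SS11 quad sandwich p114114; continuity of the dictionary quads = named fact
`SchrammSmirnov2011_lemma_5_1` at `∂D`-sided quads (parallelogram case p95826); MISSING: the
lattice↔quad two-inclusion lemma (M–L) and the Jordan-quad construction (M). (e) Borel decoder by
Lusin–Souslin (DecoderMeasurable p114120) + orbit transport (formal). What keeps R1 conjecture-grade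
for GENERAL Jordan domains even along this method: the boundary half of no-seal and SS11 L5.1 for
rough quads; for lattice-aligned / piecewise-smooth domains every remaining piece is provable or a
printed named fact — GPS13's Question 10 in joint, E-blind form is the honest label of the whole.

## Disproof.lean obligations honoured (cdisprove g1–g4; Negative/* landed)
Both antecedents are used exactly once (covariance); both guards (`ZdDiscretisationFamily`,
`0 < δs n`) are hypotheses of R1/R2′; vacuity channels closed (`subseqQuadLimits_nonempty`,
`isProbabilityMeasure_of_isSubseqQuadLimit`); NC1 `interfaces_merge_of_handsOff'`
(Negative/DictionaryMerging) applies verbatim to R1 and is asserted openly (E-blindness); no-trace is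
DERIVED (p82328), never assumed (`arcFamily_violates_noTracing`); `stopAt` discontinuity targets
forbid any a.s.-continuity-of-`stopAt` step (none is used: LocalityPassage is a lattice coupling);
ArcSwap universality (Negative/ArcSwap*) is CONTAINED in R2′ (via `hcar`) and budgeted there; no
`<stub>_false` theorem exists for any stub of this line.
-/

noncomputable section

open MeasureTheory Filter Set Topology
open scoped unitInterval BoundedContinuousFunction
open Literature.Probability.Percolation Literature.Probability.LatticeModels
open Literature.Probability.RandomPlanarGeometry Literature.Probability.Percolation.QuadCrossing
open Summit.CriticalPhenomena.CardyFormulaZ2.Theses.CardySelfRefinement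

namespace Summit.CriticalPhenomena.CardyFormulaZ2.Cruxes.LagHandOff.HittingTournament

open Summit.CriticalPhenomena.CardyFormulaZ2.Cruxes.LagHandOff.CrosscutDictionary

/-! ## Stubs (the two registered open lemmas of the line; both conjecture-grade as wholes) -/

/-- **R1 `stub_quadTransfer` — the quad → interface transfer on Jordan domains (conjecture-grade).**
GPS13 (arXiv:1008.1378) Question 10, p. 16, transplanted to `ℤ²` subsequential limits (p. 10) in
the joint form of GPS13 Cor. 9 / Holden–Sun (arXiv:1905.13207) Prop. 6.25, p. 108: ONE Borel,
exactly similarity-equivariant decoder `Ψ D : ℋ_ℂ → CurveClass ℂ` such that along EVERY positive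
mesh sequence on which the full-plane quad-crossing laws converge to `μ`, for EVERY Dobrushin
domain and EVERY admissible discretisation family, (configuration, interface) → `(S, Ψ D S)`
jointly in law.  Necessary condition certified by the adversary: NC1
`Negative.interfaces_merge_of_handsOff'` (interfaces of two admissible families of one domain
merge pathwise).  The line's method (a)–(e) for it is summarised in the module docstring. -/
theorem stub_quadTransfer :
    ∃ Ψ : DobrushinDomain → QuadConfig (Set.univ : Set ℂ) → CurveClass ℂ,
      (∀ D : DobrushinDomain, Measurable (Ψ D)) ∧
      (∀ (D : DobrushinDomain) (c : ℂ) (hc : c ≠ 0) (w : ℂ) (S : QuadConfig (Set.univ : Set ℂ)),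
        Ψ (D.map (similarity c hc w)) (S.mapHomeomorph (similarity c hc w)) =
          (Ψ D S).map (similarity c hc w : C(ℂ, ℂ))) ∧
      (∀ (μ : FiniteMeasure (QuadConfig (Set.univ : Set ℂ))) (δs : ℕ → ℝ), (∀ n, 0 < δs n) →
        Tendsto δs atTop (𝓝 0) →
        Tendsto (fun n => z2QuadLaw (Set.univ : Set ℂ) (δs n)) atTop (𝓝 μ) →
        ∀ (D : DobrushinDomain) (E : ℝ → DiscreteDobrushin), ZdDiscretisationFamily D E →
          ∀ f : (QuadConfig (Set.univ : Set ℂ) × CurveClass ℂ) →ᵇ ℝ,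
            Tendsto (fun n => ∫ ω, f (z2QuadConfig (Set.univ : Set ℂ) (δs n) ω,
                Literature.Probability.Percolation.bondInterfaceIn D (E (δs n)) ω) ∂(bondPercolation (zdGraph 2) half))
              atTop (𝓝 (∫ S, f (S, Ψ D S) ∂(μ : Measure (QuadConfig (Set.univ : Set ℂ)))))) := by
  sorry

/-- **R2‴ `stub_slitHandOffDyadic` — the slit hand-off on DYADIC POLYGONS (conjecture-grade
residue of R2′ after the landed reductions `stub_limitMarkov_of_core` p122633 and
`stub_slitHandOff_of_dyadic` p126575).**  For every subsequential quad-crossing limit `μ` and every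
chordal family `P` PINNED by `μ` (discretisability given): ONE slit kernel `K (U; x, b)` —
probability laws indexed by (remaining open set, tip, target), Borel along pasts — which
(i) disintegrates every `P D` at the first hitting of every dyadic polygon (finite union of closed
dyadic squares of one level) through `K (remainingDomain D ·; tip, b)` — the SLIT IDENTIFICATION of
the conditional law of the future in interface-lined slit domains along the same mesh subsequence,
on a countable class of axis-parallel stopping sets (Werner 2007 §3.2 (2) "is `P_{D_t,γ_t,c}`";
nothing in print for `ℤ²` sublimits: Smirnov ICM 2006 §4.2, GPS13 arXiv:1008.1378 p. 16) — and
(ii) is `P D`-a.s. weakly continuous along `γ.stopAt (G k) → γ.stopAt (⋂ G k)` for antitone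
sequences of dyadic polygons — the path regularity of the slit law (Feller/Knight-type; for the
conformally invariant limit: Carathéodory continuity of SLE₆ laws), by the martingale analysis of
…SlitHandOffMartingale.lean equivalent, given (i), to the identification at the limit set.  It
contains the (ab)/(ba) wiring universality (`K` is indexed by bare sets).  Everything else in
`IsDomainMarkov` is proved (…KernelGluing, …LimitMarkov, …SlitHandOffDyadic, …MarkovKernel). -/
theorem stub_slitHandOffDyadic :
    ∀ μ ∈ subseqQuadLimits (Set.univ : Set ℂ), ∀ P : ChordalFamily, (∀ δs : ℕ → ℝ, (∀ n, 0 < δs n) → Tendsto δs atTop (𝓝 0) → Tendsto (fun n => z2QuadLaw (Set.univ : Set ℂ) (δs n)) atTop (𝓝 μ) → ∀ (D : DobrushinDomain) (E : ℝ → DiscreteDobrushin), ZdDiscretisationFamily D E → ∀ f : CurveClass ℂ →ᵇ ℝ, Tendsto (fun n => ∫ ω, f (Literature.Probability.Percolation.bondInterfaceIn D (E (δs n)) ω) ∂(bondPercolation (zdGraph 2) half)) atTop (𝓝 (∫ γ, f γ ∂(P D)))) → (∀ D : DobrushinDomain, ∃ E : ℝ → DiscreteDobrushin, ZdDiscretisationFamily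 D E) → ∃ K : Set ℂ → ℂ → ℂ → Measure (CurveClass ℂ), (∀ U x b, IsProbabilityMeasure (K U x b)) ∧ (∀ (D : DobrushinDomain) (T : Set (CurveClass ℂ)), MeasurableSet T → Measurable fun p : CurveClass ℂ => K (remainingDomain D p) p.target (D.pt 1) T) ∧ (∀ (D : DobrushinDomain) (G : Set ℂ), (∃ (n : ℕ) (s : Finset (ℤ × ℤ)), G = ⋃ p ∈ s, {z : ℂ | z.re ∈ Set.Icc ((p.1 : ℝ) / 2 ^ n) (((p.1 : ℝ) + 1) / 2 ^ n) ∧ z.im ∈ Set.Icc ((p.2 : ℝ) / 2 ^ n) (((p.2 : ℝ) + 1) / 2 ^ n)}) → ∀ S T : Set (CurveClass ℂ), MeasurableSet S → MeasurableSet T → P D (CurveClass.stopAt G ⁻¹' S ∩ CurveClass.startFrom G ⁻¹' T) = ∫⁻ γ in CurveClass.stopAt G ⁻¹' S, K (remainingDomain D (γ.stopAt G)) (γ.stopAt G).target (D.pt 1) T ∂(P D)) ∧ ∀ (D : DobrushinDomain) (G : ℕ → Set ℂ), (∀ k, ∃ (n : ℕ) (s : Finset (ℤ × ℤ)), G k =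 ⋃ p ∈ s, {z : ℂ | z.re ∈ Set.Icc ((p.1 : ℝ) / 2 ^ n) (((p.1 : ℝ) + 1) / 2 ^ n) ∧ z.im ∈ Set.Icc ((p.2 : ℝ) / 2 ^ n) (((p.2 : ℝ) + 1) / 2 ^ n)}) → Antitone G → ∀ g : CurveClass ℂ →ᵇ ℝ, ∀ᵐ γ ∂(P D), Tendsto (fun k => ∫ x, g x ∂(K (remainingDomain D (γ.stopAt (G k))) (γ.stopAt (G k)).target (D.pt 1))) atTop (𝓝 (∫ x, g x ∂(K (remainingDomain D (γ.stopAt (⋂ k, G k))) (γ.stopAt (⋂ k, G k)).target (D.pt 1)))) := by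
  sorry

/-! ## Glue (sorry-free, LANDED: `lagHandOff_of_stubs`, p127346): R1 + R2‴ ⇒ `LagHandOff` -/

/-- **`LagHandOff` from R1 and R2‴** — one line over the landed conditional composition
`lagHandOff_of_stubs` (Theorems/CardySelfRefinementLagHandOffReduction.lean, p127346), which itself
uses landed theorems only: clause (i) outright (p72336); SS11 subsequence extraction (p71502);
chordality (p72122); similarity covariance — the ONLY use of the antecedents — (p71518 + p71750);
R2‴ ⇒ R2″ ⇒ R2′ (p126575, p122633); locality / target independence (p74694 fed by R3a p123412, R3b
p118156, carrier dependence from Markov); discretisability of every Dobrushin domain (p106229);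
no boundary tracing for every `D` (p82328). -/
theorem LagHandOff_of : LagHandOff :=
  lagHandOff_of_stubs stub_quadTransfer stub_slitHandOffDyadic

/-- The crux, by name (lead's closing theorem: sorry-free once both `stub_*` are replaced by landed
helpers; its type is literally the route decl). -/
theorem lagHandOff_proof :
    Summit.CriticalPhenomena.CardyFormulaZ2.Theses.CardySelfRefinement.LagHandOff :=
  LagHandOff_of

end Summit.CriticalPhenomena.CardyFormulaZ2.Cruxes.LagHandOff.HittingTournament

end
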